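import Summits.CriticalPhenomena.PercolationContinuityZ3.Theorems.PercNearOneGluingNoHeavyLowerTailFKExactEval
import Summits.CriticalPhenomena.PercolationContinuityZ3.Theorems.PercNearOneGluingNoHeavyLowerTailRefinedRowR3Switching
import HarnessLib

/-!
# REFUTATION of "PINNED R1": dual BHK with a pinned vertex is NOT a law of percolation (exact six-vertex witness)

builds on p205010 (kernel theorem, internal audit signed; external expert review pending).  Support file (`--supports
stmt-CriticalPhenomena-4575`), seat `prim-nh-lead-4575` (lead gen 109), answering the random-cluster lane's conjecture
"PINNED-R1" (`run/shared/lean/prim/prim-gen-kcluster/KCLUSTER-gen58.md`, Addenda B3/D/E; `run/shared/lean/prim/INEQ-CLAIMS.md`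
l.3498 (10)).  Every number below is an exact rational decided by the KERNEL (`decide +kernel`; no `native_decide`); no definitions of
mathematical content (only Boolean event readers on the `2⁷` configurations of the listed pairs and a cheap mass function), no named
facts, no sorries.  Memo `run/shared/lean/prim/prim-nh-lead-4575/LEAD-GEN109.md` §1; engines `…/lab-gen109/pinned/`.

THE ROW.  Bernoulli bond percolation `μ = prodBernoulli w` on a finite weighted graph with support `D`, apex `a`, a "pinned" vertex `u`
and two terminals `b, c`; `cl X a` the open cluster of `a` (`Literature…Gladkov.cl`), `Sep D W b c` = "the vertex set `W` meets every
`b–c` path of the support" (`RefinedRowR3.Sep`, the separation of the refined cell `s_a`).  THEOREM R1 of the tree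
(`RefinedRowR1.r1_PrW` = prim-ineq-gen-2's dual BHK inequality `DualBHK.dualBHK`; measure form `SepDual.r1_prodBernoulli`) reads, in its
"form (P)" (`DualBHKSep.t_mul_sep_le`), `μ(b,c ∈ cl a)·μ(Sep D (cl a) b c) ≤ μ(b ∈ cl a)·μ(c ∈ cl a)`.  PINNED-R1 is the same
inequality with EVERY event intersected with `{u ∈ cl a}`:
  `μ(b,c,u ∈ cl a) · μ(u ∈ cl a, Sep D (cl a) b c) ≤ μ(b,u ∈ cl a) · μ(c,u ∈ cl a)`     (PINNED-R1)
(equivalently, for the law jointly with `{u ∈ cl a}`: `T·S ≤ U_b·U_c` in the refined cells).  It was proposed as the `q → ∞`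
coefficient (`c₀`) of the wired separation lemma WSEP(2,2) of that lane's hybrid peeling prover (WSEP(2,2) ⟸ C0 ∧ C1, C0 = PINNED-R1),
census-clean there (0/3 000 random instances + climbs), and conjectured to follow at `q = 1` from a pinned `DualBHK.master_univ`.

**PINNED-R1 IS FALSE, already for Bernoulli percolation (`q = 1`).**  WITNESS (this seat; found by an EXHAUSTIVE census of all graphs
on `≤ 7` vertices × all placements with an independent exact engine, then weight climbing): the 6-cycle `0–1–5–3–2–4–0` with the
chord `45`, i.e. listed pairs `01, 04, 15, 23, 24, 35, 45` with `p(01) = p(23) = 11/12`, `p(04) = p(24) = 1/12`, `p(15) = p(35) = 3/4`,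
`p(45) = 1/4`; apex `a = 0`, pinned `u = 2`, terminals `b = 1`, `c = 3`.  Exactly (`Z = 1`):
`μ(1,3,2 ∈ cl 0) = 641683/1327104`, `μ(2 ∈ cl 0, Sep) = 107161/221184`, `μ(1,2 ∈ cl 0) = μ(3,2 ∈ cl 0) = 53527/110592`, so
  `μ(b,c,u ∈ cl a)·μ(u ∈ cl a, Sep) − μ(b,u ∈ cl a)·μ(c,u ∈ cl a) = 38467/293534171136 = +1.31·10⁻⁷ > 0`
(`PinnedR1Cex.pinnedR1_lt`); in the cells of the pinned law `T = 641683/1327104`, `U_b = U_c = 641/1327104`, `S = 1/1327104` and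
`T·S/(U_b U_c) = 1.5617`.  The same weights violate the random-cluster version at `q = ½, 2, 5, 30` (engine census; not in this file).
MECHANISM: `u = 2` sits behind BOTH terminals (`2–3` and, through `5`, `1`; the direct link `2–4–0` is weak): given `u ∈ cl a` the cheap
routes run through `b` or `c`, so pinning `u` makes `{b ∈ cl a}`, `{c ∈ cl a}` strongly NEGATIVELY correlated — strongly enough to beat
the separation factor.  Contrast: R1 itself (`u` not pinned) is a theorem, and all graphs on `≤ 5` vertices satisfy PINNED-R1 in the
seat's census (3 weight palettes, `q ∈ {½,1,2,5,30}`).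
METHOD: the kernel-arithmetic bridge `FK.RCEval` (`…LowerTailFKExactEval.lean`) at cluster weight `q = 1`
(`rcMeasureW w 1 ∅ = prodBernoulli w`); the events are read by `FK.RCEval.reachB` (`reachB_iff`) through the NEW generic readers
`PinnedR1Cex.mem_cl_conf` (membership in `cl ω.toFinset x` on a listed configuration) and `PinnedR1Cex.sep_conf_iff` (`RefinedRowR3.Sep`
on a listed configuration = non-reachability through the listed pairs whose two ends avoid the cluster), valid for every listed graph.
CLASSIFICATION: refuted-substantive (house conjecture of the random-cluster lane; the load-bearing claim "R1 survives conditioning all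
four events on a pinned vertex of the apex cluster" is false at `q = 1` by a margin of `56 %` in cell form; no cheap repair — WSEP(2,2)
itself, the statement it was meant to serve, survives the same exhaustive census and is recorded as open).
[cite: VandenbergHaggstromKahn2005, Thm. 1.2–1.3 (pp. 5–6)] [cite: Grimmett2006, §1.4 eq. (1.20) (p. 15)]
-/

namespace Summit.CriticalPhenomena.PercolationContinuityZ3.Theorems

open MeasureTheory Literature.Probability.LatticeModels Literature.Probability.Percolation
open Literature.Probability.Percolation.Gladkov (cl touch mem_cl mem_touch)
open scoped Classical

namespace PinnedR1Cex

/-! ### Generic readers on a listed graph: cluster membership and support separation -/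

section Readers

variable {D : FK.RCEval}

/-- On a listed configuration, membership in the Gladkov cluster `cl ω.toFinset x` is computable open reachability. [folklore] -/
theorem mem_cl_conf (t : Finset (Fin D.m)) [Fintype ↥(D.conf t)] (x v : Fin D.n) :
    v ∈ cl (D.conf t).toFinset x ↔ D.reachB t x v = true := by
  rw [mem_cl, Set.coe_toFinset, FK.RCEval.reachB_iff]

variable (D) in
/-- The indices of the listed pairs whose two endpoints avoid the open cluster of `a` (computable). [folklore] -/
def offCluster (t : Finset (Fin D.m)) (a : Fin D.n) : Finset (Fin D.m) :=
  Finset.univ.filter fun i => D.reachB t a (D.src i) = false ∧ D.reachB t a (D.dst i) = false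

variable (D) in
/-- Computable reader of `RefinedRowR3.Sep (listed pairs) (cl a) b c`: `c` is NOT reachable from `b` through listed pairs avoiding
the open cluster of `a`. [folklore] -/
def sepB (t : Finset (Fin D.m)) (a b c : Fin D.n) : Bool := !D.reachB (offCluster D t a) b c

/-- The support pairs not touching the cluster of `a` are exactly the listed pairs indexed by `offCluster`. [folklore] -/
theorem support_sdiff_touch_eq (t : Finset (Fin D.m)) [Fintype ↥(D.conf t)] (a : Fin D.n) :
    Finset.univ.image D.edge \ touch (cl (D.conf t).toFinset a) = (offCluster D t a).image D.edge := by
  ext e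
  simp only [Finset.mem_sdiff, Finset.mem_image, Finset.mem_univ, true_and, mem_touch, mem_cl_conf, offCluster,
    Finset.mem_filter, not_exists, not_and]
  constructor
  · rintro ⟨⟨i, rfl⟩, hne⟩
    refine ⟨i, ⟨?_, ?_⟩, rfl⟩
    · cases h : D.reachB t a (D.src i)
      · rfl
      · exact absurd (Sym2.mem_mk_left (D.src i) (D.dst i)) (hne (D.src i) h)
    · cases h : D.reachB t a (D.dst i)
      · rfl
      · exact absurd (Sym2.mem_mk_right (D.src i) (D.dst i)) (hne (D.dst i) h)
  · rintro ⟨i, ⟨hs, hd⟩, rfl⟩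
    refine ⟨⟨i, rfl⟩, fun v hv hve => ?_⟩
    unfold FK.RCEval.edge at hve
    rw [Sym2.mem_iff] at hve
    rcases hve with rfl | rfl
    · rw [hs] at hv; exact Bool.false_ne_true hv
    · rw [hd] at hv; exact Bool.false_ne_true hv

/-- **`sepB` computes the support separation** of `RefinedRowR3.Sep` for the support "all listed pairs". [folklore] -/
theorem sep_conf_iff (t : Finset (Fin D.m)) [Fintype ↥(D.conf t)] (a b c : Fin D.n) :
    RefinedRowR3.Sep (Finset.univ.image D.edge) (cl (D.conf t).toFinset a) b c ↔ sepB D t a b c = true := by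
  unfold RefinedRowR3.Sep sepB
  rw [support_sdiff_touch_eq, mem_cl]
  have hc : (↑((offCluster D t a).image D.edge) : Set (Sym2 (Fin D.n))) = D.conf (offCluster D t a) := rfl
  rw [hc, ← FK.RCEval.reachB_iff, Bool.not_eq_true', Bool.not_eq_true]

end Readers

/-! ### The witness -/

/-- The witness as listed data: six vertices, pairs `01, 04, 15, 23, 24, 35, 45` with weights
`11/12, 1/12, 3/4, 11/12, 1/12, 3/4, 1/4`, cluster weight `q = 1`. (this seat, gen 109) -/
abbrev G : FK.RCEval := ⟨6, 7, ![0, 0, 1, 2, 2, 3, 4], ![1, 4, 5, 3, 4, 5, 5],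
  ![11 / 12, 1 / 12, 3 / 4, 11 / 12, 1 / 12, 3 / 4, 1 / 4], 1⟩

/-- The listing is valid. [folklore] -/
theorem G_valid : G.Valid := by decide +kernel

/-- The support: the seven listed pairs as a finite set. (this seat, gen 109) -/
abbrev Dsupp : Finset (Sym2 (Fin 6)) := Finset.univ.image G.edge

/-- `Σ_t [P t] · ∏_i (c_i or 1 − c_i)` — the mass of a predicate under the product weights (computable, no cluster count). [folklore] -/
def massW (P : Finset (Fin 7) → Bool) : ℚ := ∑ t : Finset (Fin 7), if P t then G.wQ t else 0

/-- At `q = 1`, `massQ = massW`. [folklore] -/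
theorem massQ_eq_massW (P : Finset (Fin 7) → Bool) : G.massQ P = massW P := by
  unfold FK.RCEval.massQ massW FK.RCEval.mQ
  refine Finset.sum_congr rfl fun t _ => ?_
  have hq : G.q = 1 := rfl
  rw [hq, one_pow, mul_one]

/-- At `q = 1`, `ZQ = Σ_t wQ t`. [folklore] -/
theorem zq_eq : G.ZQ = massW (fun _ => true) := by
  unfold FK.RCEval.ZQ massW FK.RCEval.mQ
  refine Finset.sum_congr rfl fun t _ => ?_
  have hq : G.q = 1 := rfl
  rw [hq, one_pow, mul_one, if_pos rfl]

/-- `T ∩ U = {1, 3, 2 ∈ cl 0}` by open walks (`a = 0`, `b = 1`, `c = 3`, pinned `u = 2`). -/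
def pT (t : Finset (Fin 7)) : Bool := G.reachB t 0 1 && (G.reachB t 0 3 && G.reachB t 0 2)
/-- `U ∩ Sep = {2 ∈ cl 0, cl 0 separates 1 from 3 in the support}`. -/
def pS (t : Finset (Fin 7)) : Bool := G.reachB t 0 2 && sepB G t 0 1 3
/-- `{1, 2 ∈ cl 0}`. -/
def pUb (t : Finset (Fin 7)) : Bool := G.reachB t 0 1 && G.reachB t 0 2
/-- `{3, 2 ∈ cl 0}`. -/
def pUc (t : Finset (Fin 7)) : Bool := G.reachB t 0 3 && G.reachB t 0 2

/-! ### Kernel arithmetic (`decide +kernel`, `2⁷` configurations each) -/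

set_option maxHeartbeats 0 in
/-- `Z = 1`. [folklore] -/
theorem massW_true : massW (fun _ => true) = 1 := by decide +kernel
set_option maxHeartbeats 0 in
/-- mass of `T ∩ U`. (this seat, gen 109; two independent exact engines agree) -/
theorem mass_T : massW pT = 641683 / 1327104 := by decide +kernel
set_option maxHeartbeats 0 in
/-- mass of `U ∩ Sep`. -/
theorem mass_S : massW pS = 107161 / 221184 := by decide +kernel
set_option maxHeartbeats 0 in
/-- mass of `{b, u ∈ cl a}`. -/
theorem mass_Ub : massW pUb = 53527 / 110592 := by decide +kernel
set_option maxHeartbeats 0 in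
/-- mass of `{c, u ∈ cl a}`. -/
theorem mass_Uc : massW pUc = 53527 / 110592 := by decide +kernel

/-! ### From the readers to the events of the statement -/

/-- Membership in `T ∩ U`. -/
theorem mem_T (t : Finset (Fin 7)) :
    G.conf t ∈ {ω : BondConfig (Fin 6) | (1 : Fin 6) ∈ cl ω.toFinset 0 ∧ (3 : Fin 6) ∈ cl ω.toFinset 0 ∧
      (2 : Fin 6) ∈ cl ω.toFinset 0} ↔ pT t = true := by
  rw [Set.mem_setOf_eq, mem_cl_conf, mem_cl_conf, mem_cl_conf]
  unfold pT; rw [Bool.and_eq_true, Bool.and_eq_true]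

/-- Membership in `U ∩ Sep`. -/
theorem mem_S (t : Finset (Fin 7)) :
    G.conf t ∈ {ω : BondConfig (Fin 6) | (2 : Fin 6) ∈ cl ω.toFinset 0 ∧
      RefinedRowR3.Sep Dsupp (cl ω.toFinset 0) (1 : Fin 6) 3} ↔ pS t = true := by
  rw [Set.mem_setOf_eq, mem_cl_conf, sep_conf_iff]
  unfold pS; rw [Bool.and_eq_true]

/-- Membership in `{b, u ∈ cl a}`. -/
theorem mem_Ub (t : Finset (Fin 7)) :
    G.conf t ∈ {ω : BondConfig (Fin 6) | (1 : Fin 6) ∈ cl ω.toFinset 0 ∧ (2 : Fin 6) ∈ cl ω.toFinset 0} ↔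
      pUb t = true := by
  rw [Set.mem_setOf_eq, mem_cl_conf, mem_cl_conf]
  unfold pUb; rw [Bool.and_eq_true]

/-- Membership in `{c, u ∈ cl a}`. -/
theorem mem_Uc (t : Finset (Fin 7)) :
    G.conf t ∈ {ω : BondConfig (Fin 6) | (3 : Fin 6) ∈ cl ω.toFinset 0 ∧ (2 : Fin 6) ∈ cl ω.toFinset 0} ↔
      pUc t = true := by
  rw [Set.mem_setOf_eq, mem_cl_conf, mem_cl_conf]
  unfold pUc; rw [Bool.and_eq_true]

/-! ### The four measures as real numbers -/

/-- At `q = 1` the random-cluster measure of the listing is the Bernoulli product measure. [cite: Grimmett2006, §1.3] -/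
theorem rc_eq : rcMeasureW G.w ((G.q : ℚ) : ℝ) ∅ = prodBernoulli G.w := by
  have : ((G.q : ℚ) : ℝ) = 1 := by norm_num [G]
  rw [this]; exact rcMeasureW_one G.w ∅

/-- `μ(T ∩ U)` at the witness, exactly. -/
theorem real_T : (prodBernoulli G.w).real
    {ω : BondConfig (Fin 6) | (1 : Fin 6) ∈ cl ω.toFinset 0 ∧ (3 : Fin 6) ∈ cl ω.toFinset 0 ∧ (2 : Fin 6) ∈ cl ω.toFinset 0} =
      ((641683 / 1327104 : ℚ) : ℝ) := by
  have h := FK.RCEval.real_eq_massQ_div G_valid mem_T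
  rw [rc_eq, massQ_eq_massW, mass_T, zq_eq, massW_true, div_one] at h
  exact h

/-- `μ(U ∩ Sep)` at the witness, exactly. -/
theorem real_S : (prodBernoulli G.w).real
    {ω : BondConfig (Fin 6) | (2 : Fin 6) ∈ cl ω.toFinset 0 ∧ RefinedRowR3.Sep Dsupp (cl ω.toFinset 0) (1 : Fin 6) 3} =
      ((107161 / 221184 : ℚ) : ℝ) := by
  have h := FK.RCEval.real_eq_massQ_div G_valid mem_S
  rw [rc_eq, massQ_eq_massW, mass_S, zq_eq, massW_true, div_one] at h
  exact h

/-- `μ(b, u ∈ cl a)` at the witness, exactly. -/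
theorem real_Ub : (prodBernoulli G.w).real
    {ω : BondConfig (Fin 6) | (1 : Fin 6) ∈ cl ω.toFinset 0 ∧ (2 : Fin 6) ∈ cl ω.toFinset 0} =
      ((53527 / 110592 : ℚ) : ℝ) := by
  have h := FK.RCEval.real_eq_massQ_div G_valid mem_Ub
  rw [rc_eq, massQ_eq_massW, mass_Ub, zq_eq, massW_true, div_one] at h
  exact h

/-- `μ(c, u ∈ cl a)` at the witness, exactly. -/
theorem real_Uc : (prodBernoulli G.w).real
    {ω : BondConfig (Fin 6) | (3 : Fin 6) ∈ cl ω.toFinset 0 ∧ (2 : Fin 6) ∈ cl ω.toFinset 0} =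
      ((53527 / 110592 : ℚ) : ℝ) := by
  have h := FK.RCEval.real_eq_massQ_div G_valid mem_Uc
  rw [rc_eq, massQ_eq_massW, mass_Uc, zq_eq, massW_true, div_one] at h
  exact h

/-! ### The refutation -/

/-- **PINNED-R1 fails at the witness**: with `μ = prodBernoulli G.w`, `a = 0`, `u = 2`, `b = 1`, `c = 3` and the support `Dsupp`,
`μ(b,u ∈ cl a)·μ(c,u ∈ cl a) < μ(b,c,u ∈ cl a)·μ(u ∈ cl a, Sep Dsupp (cl a) b c)` (margin `38467/293534171136 = 1.31·10⁻⁷`;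
cell form `T·S/(U_b U_c) = 1.5617`). (this seat, gen 109) [cite: VandenbergHaggstromKahn2005, Thm. 1.2–1.3 (pp. 5–6)] -/
theorem pinnedR1_lt :
    (prodBernoulli G.w).real {ω : BondConfig (Fin 6) | (1 : Fin 6) ∈ cl ω.toFinset 0 ∧ (2 : Fin 6) ∈ cl ω.toFinset 0} *
        (prodBernoulli G.w).real {ω : BondConfig (Fin 6) | (3 : Fin 6) ∈ cl ω.toFinset 0 ∧ (2 : Fin 6) ∈ cl ω.toFinset 0} <
      (prodBernoulli G.w).real {ω : BondConfig (Fin 6) | (1 : Fin 6) ∈ cl ω.toFinset 0 ∧ (3 : Fin 6) ∈ cl ω.toFinset 0 ∧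
          (2 : Fin 6) ∈ cl ω.toFinset 0} *
        (prodBernoulli G.w).real {ω : BondConfig (Fin 6) | (2 : Fin 6) ∈ cl ω.toFinset 0 ∧
          RefinedRowR3.Sep Dsupp (cl ω.toFinset 0) (1 : Fin 6) 3} := by
  rw [real_Ub, real_Uc, real_T, real_S]
  norm_num

/-- The weights vanish off the support. [folklore] -/
theorem w_off_support : ∀ e, e ∉ Dsupp → G.w e = 0 := by
  intro e he
  have hr : e ∉ Set.range G.edge := fun ⟨i, hi⟩ => he (Finset.mem_image.2 ⟨i, Finset.mem_univ _, hi⟩)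
  exact Set.Icc.coe_eq_zero.1 (FK.RCEval.w_eq_zero_of_notMem_range hr)

/-- The support is connected: every vertex lies in the support component of the apex. [folklore] -/
theorem conn_support : ∀ v : Fin 6, v ∈ cl Dsupp 0 := by
  intro v
  rw [mem_cl]
  have hc : (↑Dsupp : Set (Sym2 (Fin 6))) = G.conf Finset.univ := rfl
  rw [hc, ← FK.RCEval.reachB_iff]
  revert v
  decide

end PinnedR1Cex

/-- **THEOREM: "pinned R1" is NOT a law of percolation.**  It is false that for every finite weighted graph (parameters `w` supported
on a connected pair set `D`), apex `a`, pinned vertex `u` and terminals `b, c` (all distinct),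
`μ(b,c,u ∈ cl a) · μ(u ∈ cl a ∧ Sep D (cl a) b c) ≤ μ(b,u ∈ cl a) · μ(c,u ∈ cl a)` — i.e. that THEOREM R1 = dual BHK
(`RefinedRowR1.r1_PrW`, `SepDual.r1_prodBernoulli`: `μ(b,c ∈ cl a)·μ(cl a separates b|c) ≤ μ(b ∈ cl a)·μ(c ∈ cl a)` in form (P))
survives intersecting all four events with `{u ∈ cl a}`; witness `PinnedR1Cex.pinnedR1_lt` (`n = 6`, `a = 0`, `u = 2`, `b = 1`, `c = 3`).
Conjecture PINNED-R1 of the random-cluster lane (KCLUSTER-gen58 Addenda B3/D/E) at `q = 1`; refuted-substantive.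
[cite: VandenbergHaggstromKahn2005, Thm. 1.2–1.3 (pp. 5–6)] -/
theorem not_pinnedR1_prodBernoulli : ¬ (∀ (n : ℕ) (D : Finset (Sym2 (Fin n))) (w : Sym2 (Fin n) → unitInterval),
    (∀ e, e ∉ D → w e = 0) → ∀ (a u b c : Fin n), a ≠ u → a ≠ b → a ≠ c → u ≠ b → u ≠ c → b ≠ c →
    (∀ v : Fin n, v ∈ cl D a) →
    (prodBernoulli w).real {ω : BondConfig (Fin n) | b ∈ cl ω.toFinset a ∧ c ∈ cl ω.toFinset a ∧ u ∈ cl ω.toFinset a} *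
        (prodBernoulli w).real {ω : BondConfig (Fin n) | u ∈ cl ω.toFinset a ∧ RefinedRowR3.Sep D (cl ω.toFinset a) b c} ≤
      (prodBernoulli w).real {ω : BondConfig (Fin n) | b ∈ cl ω.toFinset a ∧ u ∈ cl ω.toFinset a} *
        (prodBernoulli w).real {ω : BondConfig (Fin n) | c ∈ cl ω.toFinset a ∧ u ∈ cl ω.toFinset a}) := by
  intro h
  have h6 := h 6 PinnedR1Cex.Dsupp PinnedR1Cex.G.w PinnedR1Cex.w_off_support 0 2 1 3 (by decide) (by decide) (by decide)
    (by decide) (by decide) (by decide) PinnedR1Cex.conn_support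
  exact absurd h6 (not_le.2 PinnedR1Cex.pinnedR1_lt)

end Summit.CriticalPhenomena.PercolationContinuityZ3.Theorems
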